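import Mathlib.Topology.Homotopy.Lifting
import Mathlib.Analysis.SpecialFunctions.Complex.Circle
import Literature.Topology.FourManifolds.MMSWRasmussenFiniteApproxProofs
import Literature.Analysis.SpecialFunctions.SmoothCircleLift
import HarnessLib

/-!
# Null-homologous model knots: the angle of `z - c_j` along the knot has degree zero

Towards the named fact `Literature.Topology.FourManifolds.MMSW.eventually_approxHasRasmussen`
(Manolescu–Marengon–Sarkar–Willis, arXiv:1910.08195, Thm. 1.4): MMSW's standing hypothesis
"`L` null-homologous in `#ʳ(S¹ × S²)`" is, in the model `M_r`, the tree's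
`MMSW.IsNullHomologous r K` — the plane curve `z ∘ K` is freely null-homotopic in `ℂ ∖ {c_j}`
for every `j` (`MMSWRasmussen.lean`).  Its diagrammatic content — the twist region meets the
link in as many upward as downward strands (algebraic intersection `0` with the belt disc,
MMSW §3, "`p` strands up, `p` down") — goes through the WINDING NUMBER of `z ∘ K` about `c_j`.
PROVED here, from Mathlib's homotopy lifting property of the covering `Circle.exp : ℝ → S¹`
(`IsCoveringMap.liftHomotopy`, Hatcher Prop. 1.30):

* `lift_add_two_pi_sub_const` — for a homotopy `H : [0,1] × 𝕊¹ → ℂ ∖ {c}` and a continuous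
  lift `L` of the angle of `H - c` over `[0,1] × ℝ`, the increment `L(u, θ + 2π) - L(u, θ)` is
  one constant;
* `IsNullHomologous.angle_periodic` — **every continuous angle function of `z ∘ K - c_j` along a
  null-homologous model loop is `2π`-periodic** (winding number zero);
* `IsNullHomologous.angle_periodic_of_mem_ball` — the same about any base point `a` of the hole
  (`|a - c_j| < 1`), the curve staying outside the hole: the case of the band centre `c_j + e_j`.

Everything is proved; no definitions, no named facts.

## References

* A. Hatcher, *Algebraic Topology*, CUP (2002), Prop. 1.30, §1.1 (degree). [HatcherAT2002]
* C. Manolescu, M. Marengon, S. Sarkar, M. Willis, arXiv:1910.08195, §3.1. [ManolescuMarengonSarkarWillis2023]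
-/

noncomputable section

open scoped unitInterval Topology Real
open Complex Set Function

namespace Literature.Topology.FourManifolds

/-- Local notation: `𝔼 n` is the model Euclidean space `EuclideanSpace ℝ (Fin n)`. -/
local notation "𝔼 " n:arg => EuclideanSpace ℝ (Fin n)

/-- Local notation: `𝕊 n` is the unit sphere in `EuclideanSpace ℝ (Fin (n + 1))`. -/
local notation "𝕊 " n:arg => (Metric.sphere (0 : EuclideanSpace ℝ (Fin (n + 1))) 1)

namespace MMSW

open Literature.AlgebraicTopology.Homotopy.HopfFibration (zC wC)
open Literature.Analysis.SpecialFunctions (mem_unitSphere_of_norm_eq_one lift_sub_lift_eq_const)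

variable {r : ℕ}

/-! ## Unit vectors as points of the circle -/

/-- The direction of a nonzero complex number, as a point of `Circle`. [folklore] -/
theorem norm_div_norm_eq_one {z : ℂ} (hz : z ≠ 0) : ‖z / (‖z‖ : ℂ)‖ = 1 := by
  rw [norm_div, Complex.norm_real, Real.norm_eq_abs, abs_of_pos (norm_pos_iff.2 hz),
    div_self (norm_ne_zero_iff.2 hz)]

/-- A continuous real function whose `Circle.exp` is constant is constant. [folklore] -/
theorem eq_of_exp_mul_I_eq_const {L : ℝ → ℝ} (hL : Continuous L) {v : ℂ}
    (h : ∀ θ, exp (L θ * Complex.I) = v) (θ : ℝ) : L θ = L 0 := by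
  obtain ⟨m, hm⟩ := lift_sub_lift_eq_const (v := fun _ ↦ v) hL continuous_const
    (fun θ ↦ (h θ).symm) (fun _ ↦ (h 0).symm)
  have h0 := hm 0
  simp only [sub_self, zero_eq_mul, mul_eq_zero, Int.cast_eq_zero, Real.pi_ne_zero, or_false,
    OfNat.ofNat_ne_zero] at h0
  have := hm θ
  rw [h0] at this
  simpa [sub_eq_zero] using this

/-! ## Increments of lifts along a homotopy are constant -/

/-- **Along a homotopy the `2π`-increment of an angle lift is constant.**  Let
`V : [0,1] × ℝ → ℂ` be continuous, unit-valued and `2π`-periodic in the second variable, and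
`L : [0,1] × ℝ → ℝ` a continuous lift (`V = exp (i L)`).  Then `L (u, θ + 2π) - L (u, θ)` does
not depend on `(u, θ)`. [cite: HatcherAT2002, Prop. 1.30] -/
theorem lift_add_two_pi_sub_const {V : I × ℝ → ℂ} {L : I × ℝ → ℝ} (hL : Continuous L)
    (hper : ∀ u θ, V (u, θ + 2 * π) = V (u, θ)) (hlift : ∀ p, V p = exp (L p * Complex.I))
    (p q : I × ℝ) : L (p.1, p.2 + 2 * π) - L p = L (q.1, q.2 + 2 * π) - L q := by
  -- the increment is an integer multiple of `2π`, continuous, on a connected space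
  set D : I × ℝ → ℝ := fun p ↦ L (p.1, p.2 + 2 * π) - L p with hD
  have hDc : Continuous D :=
    (hL.comp (continuous_fst.prodMk (continuous_snd.add continuous_const))).sub hL
  have hint : ∀ p, ∃ m : ℤ, D p = m * (2 * π) := fun p ↦ by
    have h : exp ((D p : ℂ) * Complex.I) = 1 := by
      rw [hD]
      push_cast
      rw [sub_mul, Complex.exp_sub, ← hlift, ← hlift]
      rw [show ((p.1, p.2 + 2 * π) : I × ℝ) = (p.1, p.2 + 2 * π) from rfl, hper p.1 p.2]
      exact div_self (by rw [hlift]; exact Complex.exp_ne_zero _)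
    obtain ⟨m, hm⟩ := Complex.exp_eq_one_iff.1 h
    refine ⟨m, ?_⟩
    have h3 := congrArg Complex.im hm
    simp at h3
    linarith
  choose m hm using hint
  have hmc : Continuous fun p ↦ ((m p : ℝ)) := by
    have : (fun p ↦ ((m p : ℝ))) = fun p ↦ D p / (2 * π) := by
      funext p; rw [hm p]; field_simp
    rw [this]; exact hDc.div_const _
  have hmz : Continuous m := Int.isClosedEmbedding_coe_real.isEmbedding.continuous_iff.2 hmc
  have hconst : m p = m q := PreconnectedSpace.constant inferInstance hmz
  show D p = D q
  rw [hm p, hm q, hconst]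

/-! ## Null-homologous loops have winding number zero about the hole centre -/

/-- **A continuous angle function of `z ∘ K - c_j` along a null-homologous loop is
`2π`-periodic** (the winding number of `z ∘ K` about `c_j` vanishes).
[cite: ManolescuMarengonSarkarWillis2023, §3.1] -/
theorem IsNullHomologous.angle_periodic {K : 𝕊 1 → 𝔼 4} (h0 : IsNullHomologous r K) (j : Fin r)
    {ψ : ℝ → ℝ} (hψ : Continuous ψ)
    (hlift : ∀ θ, (zC (K (circlePoint θ)) - holeCentre r j) /
      (‖zC (K (circlePoint θ)) - holeCentre r j‖ : ℂ) = exp (ψ θ * Complex.I)) (θ : ℝ) :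
    ψ (θ + 2 * π) = ψ θ := by
  obtain ⟨H, hHc, hHne, hH0, c₀, hH1⟩ := h0 j
  -- the unit direction of `H - c_j` as a homotopy in `Circle` over `[0,1] × ℝ`
  have hne : ∀ p : I × ℝ, H (p.1, circlePoint p.2) - holeCentre r j ≠ 0 := fun p ↦
    sub_ne_zero.2 (hHne _)
  set V : I × ℝ → ℂ := fun p ↦ (H (p.1, circlePoint p.2) - holeCentre r j) /
    (‖H (p.1, circlePoint p.2) - holeCentre r j‖ : ℂ) with hV
  have hVc : Continuous V := by
    have h1 : Continuous fun p : I × ℝ ↦ H (p.1, circlePoint p.2) - holeCentre r j :=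
      (hHc.comp (continuous_fst.prodMk (continuous_circlePoint.comp continuous_snd))).sub
        continuous_const
    exact h1.div (Complex.continuous_ofReal.comp h1.norm) fun p ↦ by
      exact_mod_cast norm_ne_zero_iff.2 (hne p)
  have hV1 : ∀ p, ‖V p‖ = 1 := fun p ↦ norm_div_norm_eq_one (hne p)
  set Vc : C(I × ℝ, Circle) := ⟨fun p ↦ ⟨V p, mem_unitSphere_of_norm_eq_one (hV1 p)⟩,
    hVc.subtype_mk _⟩ with hVc'
  -- the initial lift `ψ`
  set f₀ : C(ℝ, ℝ) := ⟨ψ, hψ⟩ with hf₀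
  have hstart : ∀ a : ℝ, Vc (0, a) = Circle.exp (f₀ a) := by
    intro a
    apply Subtype.ext
    show V (0, a) = ((Circle.exp (ψ a) : Circle) : ℂ)
    rw [Circle.coe_exp, ← hlift a, hV]
    simp only [hH0]
  -- lift the whole homotopy
  set L := Circle.isCoveringMap_exp.liftHomotopy Vc f₀ hstart with hL
  have hLlift : ∀ p, V p = exp (L p * Complex.I) := fun p ↦ by
    have h := congrFun (Circle.isCoveringMap_exp.liftHomotopy_lifts Vc f₀ hstart) p
    simp only [comp_apply] at h
    have h' := congrArg (fun x : Circle ↦ (x : ℂ)) h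
    simp only [Circle.coe_exp] at h'
    rw [hL, h']
    rfl
  have hL0 : ∀ a, L (0, a) = ψ a := fun a ↦ Circle.isCoveringMap_exp.liftHomotopy_zero Vc f₀ hstart a
  have hper : ∀ u θ', V (u, θ' + 2 * π) = V (u, θ') := fun u θ' ↦ by
    simp only [hV, periodic_circlePoint θ']
  -- at `u = 1` the homotopy is constant, so the lift is constant there
  have h1const : L (1, θ + 2 * π) - L (1, θ) = 0 := by
    have hc : Continuous fun θ' : ℝ ↦ L (1, θ') := L.continuous.comp (Continuous.prodMk_right 1)
    have hv : ∀ θ', exp (L (1, θ') * Complex.I) = V (1, 0) := fun θ' ↦ by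
      rw [← hLlift]; simp only [hV, hH1]
    rw [eq_of_exp_mul_I_eq_const hc hv (θ + 2 * π), eq_of_exp_mul_I_eq_const hc hv θ, sub_self]
  have h := lift_add_two_pi_sub_const L.continuous hper hLlift (0, θ) (1, θ)
  simp only at h
  rw [h1const, hL0, hL0, sub_eq_zero] at h
  exact h

/-! ## Moving the base point inside the hole -/

/-- **The winding number about any point of the hole vanishes too**: for a null-homologous model
loop staying outside the unit disc about `c_j` (as model knots do) and any base point `a` with
`|a - c_j| < 1`, every continuous angle function of `z ∘ K - a` is `2π`-periodic — the straight
homotopy of base points `c_j ↝ a` stays off the curve. [cite: HatcherAT2002, Prop. 1.30] -/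
theorem IsNullHomologous.angle_periodic_of_mem_ball {K : 𝕊 1 → 𝔼 4} (hK : Continuous K)
    (h0 : IsNullHomologous r K) (j : Fin r)
    (hfar : ∀ t, (1 : ℝ) ≤ ‖zC (K t) - holeCentre r j‖) {a : ℂ} (ha : ‖a - holeCentre r j‖ < 1)
    {ψ : ℝ → ℝ} (hψ : Continuous ψ)
    (hlift : ∀ θ, (zC (K (circlePoint θ)) - a) / (‖zC (K (circlePoint θ)) - a‖ : ℂ) =
      exp (ψ θ * Complex.I)) (θ : ℝ) :
    ψ (θ + 2 * π) = ψ θ := by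
  -- the moving base point `b u = c_j + u (a - c_j)` stays in the hole, off the curve
  set b : I → ℂ := fun u ↦ holeCentre r j + ((u : ℝ) : ℂ) * (a - holeCentre r j) with hb
  have hbc : Continuous b :=
    continuous_const.add ((Complex.continuous_ofReal.comp continuous_subtype_val).mul continuous_const)
  have hne : ∀ p : I × ℝ, zC (K (circlePoint p.2)) - b p.1 ≠ 0 := by
    intro p h
    have h1 := hfar (circlePoint p.2)
    rw [sub_eq_zero] at h
    rw [h, hb] at h1
    simp only [add_sub_cancel_left, norm_mul, Complex.norm_real, Real.norm_eq_abs] at h1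
    have hu : |((p.1 : ℝ))| ≤ 1 := by
      rw [abs_of_nonneg p.1.2.1]; exact p.1.2.2
    have : |((p.1 : ℝ))| * ‖a - holeCentre r j‖ < 1 := by
      calc |((p.1 : ℝ))| * ‖a - holeCentre r j‖ ≤ 1 * ‖a - holeCentre r j‖ := by
            gcongr
        _ < 1 := by rw [one_mul]; exact ha
    linarith
  set V : I × ℝ → ℂ := fun p ↦ (zC (K (circlePoint p.2)) - b p.1) /
    (‖zC (K (circlePoint p.2)) - b p.1‖ : ℂ) with hV
  have hzc : Continuous fun θ : ℝ ↦ zC (K (circlePoint θ)) :=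
    (contDiff_zC (n := ⊤)).continuous.comp (hK.comp continuous_circlePoint)
  have hVc : Continuous V := by
    have h1 : Continuous fun p : I × ℝ ↦ zC (K (circlePoint p.2)) - b p.1 :=
      (hzc.comp continuous_snd).sub (hbc.comp continuous_fst)
    exact h1.div (Complex.continuous_ofReal.comp h1.norm) fun p ↦ by
      exact_mod_cast norm_ne_zero_iff.2 (hne p)
  have hV1 : ∀ p, ‖V p‖ = 1 := fun p ↦ norm_div_norm_eq_one (hne p)
  set Vc : C(I × ℝ, Circle) := ⟨fun p ↦ ⟨V p, mem_unitSphere_of_norm_eq_one (hV1 p)⟩,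
    hVc.subtype_mk _⟩ with hVc'
  -- a lift of the `u = 0` slice: an angle function about `c_j`, which is periodic by `angle_periodic`
  have hb0 : b 0 = holeCentre r j := by simp [hb]
  have hb1 : b 1 = a := by simp [hb]
  obtain ⟨ψ₀, hψ₀, hlift₀⟩ := Literature.Analysis.SpecialFunctions.exists_continuous_lift_of_norm_eq_one
    (v := fun θ ↦ V (0, θ)) (hVc.comp (Continuous.prodMk_right 0)) (fun θ ↦ hV1 _)
  set f₀ : C(ℝ, ℝ) := ⟨ψ₀, hψ₀⟩ with hf₀
  have hstart : ∀ θ' : ℝ, Vc (0, θ') = Circle.exp (f₀ θ') := by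
    intro θ'
    apply Subtype.ext
    show V (0, θ') = ((Circle.exp (ψ₀ θ') : Circle) : ℂ)
    rw [Circle.coe_exp]
    exact hlift₀ θ'
  set L := Circle.isCoveringMap_exp.liftHomotopy Vc f₀ hstart with hL
  have hLlift : ∀ p, V p = exp (L p * Complex.I) := fun p ↦ by
    have h := congrFun (Circle.isCoveringMap_exp.liftHomotopy_lifts Vc f₀ hstart) p
    simp only [comp_apply] at h
    have h' := congrArg (fun x : Circle ↦ (x : ℂ)) h
    simp only [Circle.coe_exp] at h'
    rw [hL, h']
    rfl
  have hL0 : ∀ θ', L (0, θ') = ψ₀ θ' := fun θ' ↦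
    Circle.isCoveringMap_exp.liftHomotopy_zero Vc f₀ hstart θ'
  have hper : ∀ u θ', V (u, θ' + 2 * π) = V (u, θ') := fun u θ' ↦ by
    simp only [hV, periodic_circlePoint θ']
  -- degree about `c_j` is zero
  have hdeg0 : ψ₀ (θ + 2 * π) - ψ₀ θ = 0 := by
    have h := h0.angle_periodic j hψ₀ (fun θ' ↦ ?_) θ
    · rw [h, sub_self]
    · have := hlift₀ θ'
      simp only [hV, hb0] at this
      exact this
  -- hence the increment at `u = 1` (base point `a`) is zero for the lift `L (1, ·)`
  have h01 := lift_add_two_pi_sub_const L.continuous hper hLlift (0, θ) (1, θ)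
  simp only at h01
  rw [hL0, hL0, hdeg0] at h01
  -- and `ψ` is another angle function about `a`: it differs from `L (1, ·)` by a constant
  have hc1 : Continuous fun θ' : ℝ ↦ L (1, θ') := L.continuous.comp (Continuous.prodMk_right 1)
  obtain ⟨m, hm⟩ := lift_sub_lift_eq_const (v := fun θ' ↦ V (1, θ')) hψ hc1
    (fun θ' ↦ by rw [← hlift θ']; simp only [hV, hb1]) (fun θ' ↦ hLlift (1, θ'))
  have h1 := hm (θ + 2 * π)
  have h2 := hm θ
  linarith

end MMSW

end Literature.Topology.FourManifolds

end
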